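import Literature.NumberTheory.Automorphic.UnitaryThreeTorusBlockElements        -- ★ γ2b-A p841319 (+ γ2a, γ0, B-p04 p841018, (F1))
import Literature.NumberTheory.Automorphic.UnitaryThreeTorusLatticeBridge        -- ★ γ2b-B §1 p841371 (bridge; ★ γ1)
import Literature.NumberTheory.Automorphic.UnitaryThreeDoubleCosetsHKDefs         -- ★ B-p17 DEFS: `flickerKH`
import HarnessLib

/-!
# Flicker's Proposition 6 (a)(b) in the `U(Φ₃)` frame: `H = ⊔_{i ≥ 0} T_H^θ · diag(ϖ^{−i}, 1, ϖ^{i}) · K_H`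
(Flicker (1998), *Elementary proof of the fundamental lemma for a unitary group*, Prop. 6 p. 83, REMARK p. 84)

Topic `NumberTheory/Automorphic`; namespace `Literature.NumberTheory.Automorphic.UnitaryGroup`.  KERNEL mathematics only: theorems, no definition, no
named fact, no instance, no notation, no `sorry`.  Cell `pub/hodgecm-mathlib`, programme P3a, road «D-N7-inert», MAP v3 «N7-ns COUNT FROM FLICKER», brick
(F3c-γ) «LATTICE ↔ COSET TRANSPORT» FILE γ2b-B §2 = the binders `hA`∕`hB` of ★ B-p04 (g33) p840967 `FixedPointsTorusDoubleCosetCount` at `G := ↥H`,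
`T := Z_H(t_θ)`, `K := flickerKH.subgroupOf H`, `r i := diag(ϖ^{−i}, 1, ϖ^{i})` (LEAD F0P3a-plan (g9) T8-60 (C); architect A-p06 (g26)).
HC_CM is proved only modulo the printed citations (2 remaining named inputs hLiu418, h413) until rung 0 closes; this file discharges no named fact.

References: [Flicker1998UnitaryFL] Y. Z. Flicker, Canad. J. Math. 50 (1998), Prop. 6 p. 83, REMARK p. 84 · [Rogawski1990] J. D. Rogawski, Ann. of Math. Stud. 123, §4.9 p. 55. -/

set_option autoImplicit false

open Matrix
open scoped MatrixGroups WithZero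

namespace Literature.NumberTheory.Automorphic.UnitaryGroup

open Literature.NumberTheory.Automorphic.HermitianLattice (unitaryInt LocalConjDatum)

/-! ## §1 Valuation bookkeeping in `ℤᵐ⁰` -/

section Val

variable {K : Type*} [Field K] [Valued K ℤᵐ⁰]

/-- Scaling into the integers: `|ϖ^N x| ≤ 1` for `N` large (`|ϖ| = exp(−1)`). [cite: Flicker1998UnitaryFL, REMARK p. 84] -/
theorem exists_v_pow_mul_le_one {ϖ : K} (hϖ : Valued.v ϖ = WithZero.exp (-1 : ℤ)) (x : K) :
    ∃ N : ℕ, ∀ M : ℕ, N ≤ M → Valued.v (ϖ ^ M * x) ≤ 1 := by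
  by_cases hx : x = 0
  · exact ⟨0, fun M _ => by rw [hx, mul_zero, map_zero]; exact zero_le⟩
  have hvx : Valued.v x ≠ 0 := (Valuation.ne_zero_iff _).2 hx
  refine ⟨(WithZero.log (Valued.v x)).toNat, fun M hM => ?_⟩
  rw [map_mul, map_pow, hϖ, ← WithZero.exp_nsmul, ← WithZero.exp_log hvx, ← WithZero.exp_add, ← WithZero.exp_zero, WithZero.exp_le_exp]
  have := Int.self_le_toNat (WithZero.log (Valued.v x))
  have hM' : ((WithZero.log (Valued.v x)).toNat : ℤ) ≤ M := by exact_mod_cast hM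
  rw [nsmul_eq_mul]
  omega

/-- Four elements at once. [cite: Flicker1998UnitaryFL, REMARK p. 84] -/
theorem exists_v_pow_mul_le_one₄ {ϖ : K} (hϖ : Valued.v ϖ = WithZero.exp (-1 : ℤ)) (x₁ x₂ x₃ x₄ : K) :
    ∃ N : ℕ, Valued.v (ϖ ^ N * x₁) ≤ 1 ∧ Valued.v (ϖ ^ N * x₂) ≤ 1 ∧ Valued.v (ϖ ^ N * x₃) ≤ 1 ∧ Valued.v (ϖ ^ N * x₄) ≤ 1 := by
  obtain ⟨N₁, h₁⟩ := exists_v_pow_mul_le_one hϖ x₁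
  obtain ⟨N₂, h₂⟩ := exists_v_pow_mul_le_one hϖ x₂
  obtain ⟨N₃, h₃⟩ := exists_v_pow_mul_le_one hϖ x₃
  obtain ⟨N₄, h₄⟩ := exists_v_pow_mul_le_one hϖ x₄
  refine ⟨max (max N₁ N₂) (max N₃ N₄), h₁ _ ?_, h₂ _ ?_, h₃ _ ?_, h₄ _ ?_⟩ <;> omega

end Val

/-! ## §2 Flicker's Prop. 6 (a): `H = ⋃_i T_H^θ · diag(ϖ^{−i},1,ϖ^{i}) · K_H` (existence = `hA`) -/

section Main

variable {K : Type*} [Field K] [Valued K ℤᵐ⁰] {ϖ : K} (σ : K →+* K) {J : Matrix (Fin 3) (Fin 3) K}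
  (hJ : J = (StdForm.antidiagonal 3).over K) (hd : LocalConjDatum σ ϖ)

universe u

set_option maxHeartbeats 1600000 in
-- one long explicit computation (Flicker's Prop. 6 (a)); the `field_simp`/`linear_combination` entry identities dominate
include hJ hd in
/-- **FLICKER'S PROPOSITION 6 (a) — EXISTENCE OF THE DOUBLE-COSET DECOMPOSITION `H = ⋃_{i ≥ 0} T_H^θ · r_i · K_H`** in the `U(Φ₃)` frame,
`r_i = diag(ϖ^{−i}, 1, ϖ^{i})`, `T_H^θ = Z_H(t)` for a regular torus block `t = !![A,0,B;0,b,0;C,0,A] ∈ H` (`C ≠ 0`, `Bθ′ = Cθ`, `θ = ϖ^ε`, `ε ≤ 1`),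
`K_H = flickerKH` (★ B-p17): every `g ∈ H` is `τ · r_i · k` with `τ ∈ Z_H(t)`, `k ∈ K_H` — the binder `hA` of ★ `FixedPointsTorusDoubleCosetCount`
VERBATIM at `G := ↥H`.  PROOF: block shape (★ B-p17) → ★ γ0 dictionary `corner = λ·D₁⁻¹gD₁` → scaling and ★ MARS through the bridge (★ γ2b-B §1:
`diag(θ,1)⁻¹g ∝ ι_d(z)·diag(1,ϖ^j)·k₀`) → PARITY `j = 2i + ε` from `|det corner| = 1` → `τ := τ(z)` (★ γ2b-A), `k := r_i⁻¹τ⁻¹g` with matrix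
`!![mU₀, 0, mU₁∕d; 0, e, 0; mdW₀, 0, mW₁]`, `|m| = |d| = 1`, hence integral (★ `mem_unitaryInt_iff_forall_v_apply_le_one`).
The bridge binders `(R, ι, hιv, σR, hσι, dR, ϖR)` are instantiated at `R := 𝒪[K]`, `ι := subtype` by the junction (A-p03 ∕ B-p04 «=»).
[cite: Flicker1998UnitaryFL, Prop. 6 p. 83; REMARK p. 84] -/
theorem exists_mem_centralizer_mul_diagRadial_mul_mem_flickerKH
    {R : Type u} [CommRing R] [IsDomain R] [IsDiscreteValuationRing R] (ι : R →+* K) (hι : Function.Injective ι)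
    (hιv : ∀ x : K, Valued.v x ≤ 1 ↔ x ∈ Set.range ι) (σR : R →+* R) (hσR : ∀ r, σR (σR r) = r) (hσι : ∀ r, ι (σR r) = σ (ι r))
    {dR : R} (hdRσ : σR dR = -dR) (hdRu : IsUnit dR) (h2R : IsUnit (2 : R)) {ϖR : R} (hϖR : Irreducible ϖR) (hιϖ : ι ϖR = ϖ)
    {c : ↥(unitaryGroupOfForm σ J)} (hc : ((c : GL (Fin 3) K) : Matrix (Fin 3) (Fin 3) K) = !![1, 0, 0; 0, -1, 0; 0, 0, 1])
    {θ θ' : K} {ε : ℕ} (hε : ε ≤ 1) (hθε : θ = ϖ ^ ε) (hθ : θ * θ' = 1)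
    {t : ↥(unitaryGroupOfForm σ J)} (htH : t ∈ Subgroup.centralizer ({c} : Set ↥(unitaryGroupOfForm σ J))) {A B C b₀ : K}
    (hte : ((t : GL (Fin 3) K) : Matrix (Fin 3) (Fin 3) K) = !![A, 0, B; 0, b₀, 0; C, 0, A]) (hC : C ≠ 0) (hBC : B * θ' = C * θ)
    (r : ℕ → ↥(Subgroup.centralizer ({c} : Set ↥(unitaryGroupOfForm σ J))))
    (hr : ∀ i, (((r i : ↥(unitaryGroupOfForm σ J)) : GL (Fin 3) K) : Matrix (Fin 3) (Fin 3) K) = !![(ϖ ^ i)⁻¹, 0, 0; 0, 1, 0; 0, 0, ϖ ^ i])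
    (g : ↥(Subgroup.centralizer ({c} : Set ↥(unitaryGroupOfForm σ J)))) :
    ∃ i : ℕ, ∃ τ ∈ Subgroup.centralizer ({⟨t, htH⟩} : Set ↥(Subgroup.centralizer ({c} : Set ↥(unitaryGroupOfForm σ J)))),
      ∃ k ∈ (flickerKH σ J c).subgroupOf (Subgroup.centralizer ({c} : Set ↥(unitaryGroupOfForm σ J))), g = τ * r i * k := by
  classical
  -- scalar facts
  have h2 : (2 : K) ≠ 0 := fun h0 => by have := hd.v2; rw [h0, map_zero] at this; exact zero_ne_one this
  have hϖ0 : ϖ ≠ 0 := fun h0 => by have := hd.vϖ; rw [h0, map_zero] at this; exact WithZero.zero_ne_coe this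
  have hθ0 : θ ≠ 0 := by rw [hθε]; exact pow_ne_zero _ hϖ0
  have hσϖ : σ ϖ = ϖ := hd.σϖ
  have hσθ : σ θ = θ := by rw [hθε, map_pow, hσϖ]
  have hσθ' : σ θ' = θ' := by
    have h1 : θ' = θ⁻¹ := (inv_eq_of_mul_eq_one_right hθ).symm
    rw [h1, map_inv₀, hσθ]
  set d : K := ι dR with hd_def
  have hdK : σ d = -d := by rw [hd_def, ← hσι, hdRσ, map_neg]
  have hvd : Valued.v d = 1 := TorusBridge.v_eq_one_of_isUnit ι hιv hdRu
  have hd0 : d ≠ 0 := fun h0 => by rw [h0, map_zero] at hvd; exact zero_ne_one hvd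
  have hdR : IsUnit (σR dR - dR) := by
    have : σR dR - dR = -(2 * dR) := by rw [hdRσ]; ring
    rw [this]; exact (h2R.mul hdRu).neg
  have hσϖR : σR ϖR = ϖR := hι (by rw [hσι, hιϖ, hσϖ])
  -- Step 1: block shape and the dictionary
  obtain ⟨α, β, γ, δ, e, hg⟩ := exists_coe_eq_block_of_mem_centralizer σ h2 hc g.2
  have hg3 : ((g : ↥(unitaryGroupOfForm σ J)) : GL (Fin 3) K) ∈ unitaryGroupOfForm σ ((StdForm.antidiagonal 3).over K) := by
    rw [← hJ]; exact (g : ↥(unitaryGroupOfForm σ J)).2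
  obtain ⟨⟨l, hl0, hl, f1, f2, f3, f4, -⟩, he⟩ := SplitDictionary.exists_fixed_coords_of_coe_eq_block σ h2 hdK hd0 hg3 hg
  have hσl0 : σ l ≠ 0 := fun h0 => hl0 (by rw [← hl, h0, mul_zero])
  -- Step 2: scale `diag(θ,1)⁻¹ g` into the integers and apply MARS through the bridge
  obtain ⟨N, hN1, hN2, hN3, hN4⟩ := exists_v_pow_mul_le_one₄ hd.vϖ (α / l / θ) (d * β / l / θ) (γ / (d * l)) (δ / l)
  have hσϖN : σ (ϖ ^ N) = ϖ ^ N := by rw [map_pow, hσϖ]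
  obtain ⟨u, v, j, U₀, U₁, W₀, W₁, hu, hv, hvu, hvv, hz, hU₀, hU₁, hW₀, hW₁, hvU₀, hvU₁, hvW₀, hvW₁, hvk, E00, E10, E01, E11⟩ :=
    TorusBridge.exists_coords_eq_iota_diag_pow σ ι hι hιv σR hσι hσR hdR hϖR hσϖR
      !![ϖ ^ N * (α / l / θ), ϖ ^ N * (d * β / l / θ); ϖ ^ N * (γ / (d * l)), ϖ ^ N * (δ / l)]
      (by intro a b; fin_cases a <;> fin_cases b <;> simp [map_mul, map_div₀, hσϖN, hσθ, f1, f2, f3, f4] )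
      (by
        intro a b
        fin_cases a <;> fin_cases b
        · exact hN1
        · exact hN2
        · exact hN3
        · exact hN4)
      (by
        simp only [of_apply, cons_val', cons_val_zero, cons_val_one, empty_val', cons_val_fin_one]
        have hΔ : α * δ - β * γ ≠ 0 := fun h0 => hl0 (by rw [← hl, h0, zero_mul])
        have : ϖ ^ N * (α / l / θ) * (ϖ ^ N * (δ / l)) - ϖ ^ N * (d * β / l / θ) * (ϖ ^ N * (γ / (d * l))) =
            (ϖ ^ N) ^ 2 * (α * δ - β * γ) / (l ^ 2 * θ) := by field_simp
        rw [this]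
        exact div_ne_zero (mul_ne_zero (pow_ne_zero _ (pow_ne_zero _ hϖ0)) hΔ) (mul_ne_zero (pow_ne_zero _ hl0) hθ0))
  simp only [of_apply, cons_val', cons_val_zero, cons_val_one, empty_val', cons_val_fin_one, hιϖ] at E00 E10 E01 E11
  rw [← hd_def] at hz E00 E10 E01 E11
  rw [hdK] at E00 E10 E01 E11
  -- Step 3: valuations; `|αδ − βγ| = 1`, `|u² − v²d²| = |z|²`, parity `j + ε = 2(N + L)`
  have hz' : u - v * d ≠ 0 := by
    intro h0; apply hz
    have : σ (u - v * d) = 0 := by rw [h0, map_zero]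
    rw [map_sub, map_mul, hu, hv, hdK] at this
    linear_combination this
  have hvl : Valued.v (σ l) = Valued.v l := hd.vσ l
  have hvΔ : Valued.v (α * δ - β * γ) = 1 := by
    have h1 := congrArg Valued.v hl
    rw [map_mul, hvl] at h1
    have hvl0 : Valued.v l ≠ 0 := (Valuation.ne_zero_iff _).2 hl0
    exact mul_right_cancel₀ hvl0 (by rw [h1, one_mul])
  have hvzz : Valued.v (u - v * d) = Valued.v (u + v * d) := by
    have h1 : σ (u + v * d) = u - v * d := by rw [map_add, map_mul, hu, hv, hdK]; ring
    rw [← h1, hd.vσ]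
  -- the entries of `g` from the MARS identities
  have hϖN0 : ϖ ^ N ≠ 0 := pow_ne_zero _ hϖ0
  have eα : α = l * θ * (u * U₀ + v * (d * d) * (ϖ ^ j * W₀)) / ϖ ^ N := by
    have h := E00
    field_simp at h
    rw [eq_div_iff hϖN0]
    linear_combination h
  have eβ : β = l * θ * (u * U₁ + v * (d * d) * (ϖ ^ j * W₁)) / (d * ϖ ^ N) := by
    have h := E01
    field_simp at h
    rw [eq_div_iff (mul_ne_zero hd0 hϖN0)]
    linear_combination h
  have eγ : γ = l * d * (v * U₀ + u * (ϖ ^ j * W₀)) / ϖ ^ N := by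
    have h := E10
    field_simp at h
    rw [eq_div_iff hϖN0]
    linear_combination h
  have eδ : δ = l * (v * U₁ + u * (ϖ ^ j * W₁)) / ϖ ^ N := by
    have h := E11
    field_simp at h
    rw [eq_div_iff hϖN0]
    linear_combination h
  -- the determinant identity
  have hdetId : (α * δ - β * γ) * (ϖ ^ N) ^ 2 = θ * l ^ 2 * ϖ ^ j * (U₀ * W₁ - U₁ * W₀) * ((u + v * d) * (u - v * d)) := by
    rw [eα, eβ, eγ, eδ]; field_simp; ring
  -- logs
  have hvz0 : Valued.v (u + v * d) ≠ 0 := (Valuation.ne_zero_iff _).2 hz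
  have hvl0 : Valued.v l ≠ 0 := (Valuation.ne_zero_iff _).2 hl0
  have hvk0 : Valued.v (U₀ * W₁ - U₁ * W₀) = 1 := hvk
  have hvθ : Valued.v θ = WithZero.exp (-(ε : ℤ)) := by
    rw [hθε, map_pow, hd.vϖ, ← WithZero.exp_nsmul]; simp
  have hpar : (j : ℤ) + ε = 2 * ((N : ℤ) + WithZero.log (Valued.v l) + WithZero.log (Valued.v (u + v * d))) := by
    have h1 := congrArg Valued.v hdetId
    rw [map_mul, map_pow, map_pow, hd.vϖ, hvΔ, one_mul, map_mul, map_mul, map_mul, map_mul, map_mul, hvθ, map_pow, map_pow, hd.vϖ, hvk0,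
      mul_one, hvzz, ← WithZero.exp_log hvl0, ← WithZero.exp_log hvz0] at h1
    simp only [← WithZero.exp_nsmul, ← WithZero.exp_add, WithZero.exp_inj, nsmul_eq_mul] at h1
    push_cast at h1
    linarith
  -- `i := N + L − ε ≥ 0`
  obtain ⟨i, hi⟩ : ∃ i : ℕ, (j : ℤ) = 2 * i + ε := by
    have hM : (0 : ℤ) ≤ (N : ℤ) + WithZero.log (Valued.v l) + WithZero.log (Valued.v (u + v * d)) - ε := by
      interval_cases ε <;> push_cast at hpar ⊢ <;> omega
    refine ⟨((N : ℤ) + WithZero.log (Valued.v l) + WithZero.log (Valued.v (u + v * d)) - ε).toNat, ?_⟩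
    rw [Int.toNat_of_nonneg hM]; omega
  have hjε : j = 2 * i + ε := by exact_mod_cast hi
  -- Step 4: the torus element `τ(z)`
  obtain ⟨τ, hτ⟩ := exists_coe_eq_torusBlock σ hJ hd.σσ hdK hd0 hu hv hσθ hσθ' hθ hz
  have hτH : τ ∈ Subgroup.centralizer ({c} : Set ↥(unitaryGroupOfForm σ J)) := mem_centralizer_of_coe_eq_block σ hc hτ
  have hτt : τ ∈ Subgroup.centralizer ({t} : Set ↥(unitaryGroupOfForm σ J)) := torusBlock_mem_centralizer σ hτ hte hC hBC
  -- Step 5: the element `k := r_i⁻¹ τ⁻¹ g` and its matrix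
  set m : K := l * (u + v * d) * ϖ ^ (i + ε) / ϖ ^ N with hm
  have hvm : Valued.v m = 1 := by
    have hjl : WithZero.log (Valued.v l) + WithZero.log (Valued.v (u + v * d)) = (i : ℤ) + ε - N := by
      have : (j : ℤ) = 2 * i + ε := hi
      linarith
    rw [hm, map_div₀, map_mul, map_mul, map_pow, map_pow, hd.vϖ, ← WithZero.exp_log hvl0, ← WithZero.exp_log hvz0]
    simp only [← WithZero.exp_nsmul, ← WithZero.exp_add, ← WithZero.exp_sub, nsmul_eq_mul]
    rw [show WithZero.log (Valued.v l) + WithZero.log (Valued.v (u + v * d)) + ((i + ε : ℕ) : ℤ) * -1 - (N : ℤ) * -1 = 0 by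
      push_cast; linarith, WithZero.exp_zero]
  let kM : Matrix (Fin 3) (Fin 3) K := !![m * U₀, 0, m * U₁ / d; 0, e, 0; m * d * W₀, 0, m * W₁]
  -- the product identity `τM · rM · kM = gM`
  have hprod : ((τ : GL (Fin 3) K) : Matrix (Fin 3) (Fin 3) K) * (((r i : ↥(unitaryGroupOfForm σ J)) : GL (Fin 3) K) : Matrix (Fin 3) (Fin 3) K) * kM =
      (((g : ↥(unitaryGroupOfForm σ J)) : GL (Fin 3) K) : Matrix (Fin 3) (Fin 3) K) := by
    rw [hτ, hr i, block_mul_block, hg]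
    simp only [kM, block_mul_block]
    have hϖi0 : ϖ ^ i ≠ 0 := pow_ne_zero _ hϖ0
    have hjpow : ϖ ^ j = (ϖ ^ i) ^ 2 * ϖ ^ ε := by rw [hjε, pow_add, pow_mul, ← pow_mul, mul_comm 2 i, pow_mul]
    have hθ'e : θ' = (ϖ ^ ε)⁻¹ := by rw [← hθε]; exact (inv_eq_of_mul_eq_one_right hθ).symm
    -- the four corner identities
    have c00 : u / (u + v * d) * (ϖ ^ i)⁻¹ * (m * U₀) + v * d * θ / (u + v * d) * ϖ ^ i * (m * d * W₀) = α := by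
      rw [eα, hm, hjpow, hθε]; field_simp; ring
    have c02 : u / (u + v * d) * (ϖ ^ i)⁻¹ * (m * U₁ / d) + v * d * θ / (u + v * d) * ϖ ^ i * (m * W₁) = β := by
      rw [eβ, hm, hjpow, hθε]; field_simp; ring
    have c20 : v * d * θ' / (u + v * d) * (ϖ ^ i)⁻¹ * (m * U₀) + u / (u + v * d) * ϖ ^ i * (m * d * W₀) = γ := by
      rw [eγ, hm, hjpow, hθ'e]; field_simp; ring
    have c22 : v * d * θ' / (u + v * d) * (ϖ ^ i)⁻¹ * (m * U₁ / d) + u / (u + v * d) * ϖ ^ i * (m * W₁) = δ := by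
      rw [eδ, hm, hjpow, hθ'e]; field_simp; ring
    ext a b
    fin_cases a <;> fin_cases b <;> simp <;>
      first | linear_combination c00 | linear_combination c02 | linear_combination c20 | linear_combination c22
  -- Step 6: assemble
  obtain ⟨τH, hτH'⟩ : ∃ τH : ↥(Subgroup.centralizer ({c} : Set ↥(unitaryGroupOfForm σ J))), (τH : ↥(unitaryGroupOfForm σ J)) = τ :=
    ⟨⟨τ, hτH⟩, rfl⟩
  have hτHZ : τH ∈ Subgroup.centralizer ({⟨t, htH⟩} : Set ↥(Subgroup.centralizer ({c} : Set ↥(unitaryGroupOfForm σ J)))) := by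
    rw [Subgroup.mem_centralizer_singleton_iff]
    apply Subtype.ext
    change (τH : ↥(unitaryGroupOfForm σ J)) * t = t * (τH : ↥(unitaryGroupOfForm σ J))
    rw [hτH']
    exact Subgroup.mem_centralizer_singleton_iff.1 hτt
  obtain ⟨k, hk⟩ : ∃ k : ↥(Subgroup.centralizer ({c} : Set ↥(unitaryGroupOfForm σ J))), k = (r i)⁻¹ * τH⁻¹ * g := ⟨_, rfl⟩
  have hkM : (((k : ↥(unitaryGroupOfForm σ J)) : GL (Fin 3) K) : Matrix (Fin 3) (Fin 3) K) = kM := by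
    have hτu : IsUnit (((τ : GL (Fin 3) K) : Matrix (Fin 3) (Fin 3) K)).det := Matrix.isUnits_det_units _
    have hru : IsUnit ((((r i : ↥(unitaryGroupOfForm σ J)) : GL (Fin 3) K) : Matrix (Fin 3) (Fin 3) K)).det := Matrix.isUnits_det_units _
    have e1 : ((k : ↥(unitaryGroupOfForm σ J)) : GL (Fin 3) K) =
        ((r i : ↥(unitaryGroupOfForm σ J)) : GL (Fin 3) K)⁻¹ * (τ : GL (Fin 3) K)⁻¹ * ((g : ↥(unitaryGroupOfForm σ J)) : GL (Fin 3) K) := by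
      rw [hk, ← hτH']; simp only [Subgroup.coe_mul, Subgroup.coe_inv]
    rw [e1, Units.val_mul, Units.val_mul, Matrix.coe_units_inv, Matrix.coe_units_inv, ← hprod,
      Matrix.mul_assoc (((τ : GL (Fin 3) K) : Matrix (Fin 3) (Fin 3) K)), Matrix.mul_assoc, Matrix.nonsing_inv_mul_cancel_left _ _ hτu,
      Matrix.nonsing_inv_mul_cancel_left _ _ hru]
  have hve : Valued.v e = 1 := by
    have h1 := congrArg Valued.v he
    rw [map_mul, hd.vσ, map_one] at h1
    exact Literature.NumberTheory.QuadraticForms.OMeara65.WithZeroMulInt.eq_one_of_mul_self h1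
  have hkK : k ∈ (flickerKH σ J c).subgroupOf (Subgroup.centralizer ({c} : Set ↥(unitaryGroupOfForm σ J))) := by
    rw [Subgroup.mem_subgroupOf, mem_flickerKH_iff]
    refine ⟨(k : ↥(Subgroup.centralizer ({c} : Set ↥(unitaryGroupOfForm σ J)))).2, ?_⟩
    rw [mem_unitaryInt_iff_forall_v_apply_le_one σ hJ hd.vσ, hkM]
    intro a b
    fin_cases a <;> fin_cases b <;> simp [kM, hvm, hvd, hve, hvU₀, hvU₁, hvW₀, hvW₁]
  refine ⟨i, τH, hτHZ, k, hkK, ?_⟩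
  rw [hk]; group

end Main


end Literature.NumberTheory.Automorphic.UnitaryGroup
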